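import Mathlib
import HarnessLib

/-!
# Route BernsteinTemperature, item `PlanarPressureAM` — file D1: trigonometric moments

Helper file (supports item `stmt-CriticalPhenomena-10768`). The moments of `cos θ₁ + cos θ₂` over
the torus `[0, 2π]²`, which evaluate Onsager's double integral order by order in the
high-temperature variable:

* `∫₀^{2π} cos^{2l} = 2π · centralBinom l / 4ˡ`, `∫₀^{2π} cos^{2l+1} = 0`;
* `∑ᵢ C(2j,i) J_i J_{2j-i} = 4π² (centralBinom j)² / 4ʲ` and the odd analogue `= 0`, through the
  identity `C(2j,2l) · centralBinom l · centralBinom (j-l) = centralBinom j · C(j,l)²` and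
  `∑ₗ C(j,l)² = centralBinom j`.

No definitions are introduced.
-/

namespace Summit.CriticalPhenomena.Ising3DConformalLimit.Theorems

open Real Finset intervalIntegral

/-- `∫₀^{2π} cos^{2l} θ dθ = 2π · centralBinom l / 4ˡ`. [folklore] -/
theorem planarPressureAM_integral_cos_pow_even (l : ℕ) :
    ∫ θ in (0 : ℝ)..2 * π, cos θ ^ (2 * l) = 2 * π * (Nat.centralBinom l : ℝ) / 4 ^ l := by
  induction l with
  | zero => simp
  | succ l ih =>
    have h := integral_cos_pow (a := 0) (b := 2 * π) (2 * l)
    rw [show 2 * (l + 1) = 2 * l + 2 by ring, h, ih, sin_zero, sin_two_pi]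
    simp only [mul_zero, sub_zero, zero_div, zero_add]
    have hcb := Nat.succ_mul_centralBinom_succ l
    have hcb' : ((l : ℝ) + 1) * (Nat.centralBinom (l + 1) : ℝ)
        = 2 * (2 * (l : ℝ) + 1) * (Nat.centralBinom l : ℝ) := by exact_mod_cast hcb
    have hl' : ((l : ℝ) + 1) ≠ 0 := by positivity
    have hcb'' : (Nat.centralBinom (l + 1) : ℝ)
        = 2 * (2 * (l : ℝ) + 1) * (Nat.centralBinom l : ℝ) / ((l : ℝ) + 1) := by
      rw [eq_div_iff hl']; linarith [hcb']
    rw [hcb'']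
    have hl : (2 * (l : ℝ) + 2) ≠ 0 := by positivity
    push_cast
    field_simp
    ring

/-- `∫₀^{2π} cos^{2l+1} θ dθ = 0`. [folklore] -/
theorem planarPressureAM_integral_cos_pow_odd (l : ℕ) :
    ∫ θ in (0 : ℝ)..2 * π, cos θ ^ (2 * l + 1) = 0 := by
  induction l with
  | zero => simp [integral_cos]
  | succ l ih =>
    have h := integral_cos_pow (a := 0) (b := 2 * π) (2 * l + 1)
    rw [show 2 * (l + 1) + 1 = 2 * l + 1 + 2 by ring, h, ih, sin_zero, sin_two_pi]
    simp

/-- `C(2j,2l) · centralBinom l · centralBinom (j-l) = centralBinom j · C(j,l)²` (`l ≤ j`).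
[folklore] -/
theorem planarPressureAM_choose_centralBinom (j l : ℕ) (hl : l ≤ j) :
    ((2 * j).choose (2 * l) : ℚ) * (Nat.centralBinom l : ℚ) * (Nat.centralBinom (j - l) : ℚ)
      = (Nat.centralBinom j : ℚ) * ((j.choose l : ℚ)) ^ 2 := by
  have h2l : 2 * l ≤ 2 * j := by omega
  rw [Nat.centralBinom_eq_two_mul_choose, Nat.centralBinom_eq_two_mul_choose,
    Nat.centralBinom_eq_two_mul_choose,
    Nat.cast_choose ℚ h2l, Nat.cast_choose ℚ (Nat.le_mul_of_pos_left l two_pos),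
    Nat.cast_choose ℚ (Nat.le_mul_of_pos_left (j - l) two_pos),
    Nat.cast_choose ℚ (Nat.le_mul_of_pos_left j two_pos), Nat.cast_choose ℚ hl]
  have e1 : 2 * j - 2 * l = 2 * (j - l) := by omega
  have e2 : 2 * l - l = l := by omega
  have e3 : 2 * (j - l) - (j - l) = j - l := by omega
  have e4 : 2 * j - j = j := by omega
  rw [e1, e2, e3, e4]
  field_simp

/-- `∑_{l ≤ j} C(2j,2l) · centralBinom l · centralBinom (j-l) = (centralBinom j)²`. [folklore] -/
theorem planarPressureAM_sum_choose_centralBinom (j : ℕ) :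
    ∑ l ∈ range (j + 1), ((2 * j).choose (2 * l) : ℝ) * (Nat.centralBinom l : ℝ)
      * (Nat.centralBinom (j - l) : ℝ) = (Nat.centralBinom j : ℝ) ^ 2 := by
  have hq : ∑ l ∈ range (j + 1), ((2 * j).choose (2 * l) : ℚ) * (Nat.centralBinom l : ℚ)
      * (Nat.centralBinom (j - l) : ℚ) = (Nat.centralBinom j : ℚ) ^ 2 := by
    rw [Finset.sum_congr rfl fun l hl =>
      planarPressureAM_choose_centralBinom j l (Nat.lt_succ_iff.mp (Finset.mem_range.mp hl))]
    rw [← Finset.mul_sum]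
    have hs := Nat.sum_range_choose_sq j
    have hs' : ∑ l ∈ range (j + 1), ((j.choose l : ℚ)) ^ 2 = (Nat.centralBinom j : ℚ) := by
      rw [Nat.centralBinom_eq_two_mul_choose]; exact_mod_cast hs
    rw [hs']; ring
  exact_mod_cast hq

/-- The even torus moment: `∑ᵢ C(2j,i) J_i J_{2j-i} = 4π² (centralBinom j)²/4ʲ`,
`J_k = ∫₀^{2π} cos^k`. [folklore] -/
theorem planarPressureAM_moment_even (j : ℕ) :
    ∑ i ∈ range (2 * j + 1), ((2 * j).choose i : ℝ) * (∫ θ in (0 : ℝ)..2 * π, cos θ ^ i)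
      * (∫ θ in (0 : ℝ)..2 * π, cos θ ^ (2 * j - i))
      = 4 * π ^ 2 * (Nat.centralBinom j : ℝ) ^ 2 / 4 ^ j := by
  -- odd `i` contribute nothing
  rw [← Finset.sum_filter_of_ne (p := fun i => Even i) (fun i hi hne => by
    by_contra hodd
    rw [Nat.not_even_iff_odd] at hodd
    obtain ⟨k, rfl⟩ := hodd
    rw [planarPressureAM_integral_cos_pow_odd k] at hne
    simp at hne)]
  -- reindex the even `i = 2l`
  have himg : (range (2 * j + 1)).filter (fun i => Even i) = (range (j + 1)).image (fun l => 2 * l) := by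
    ext i
    simp only [Finset.mem_filter, Finset.mem_range, Finset.mem_image]
    constructor
    · rintro ⟨hi, ⟨l, rfl⟩⟩
      exact ⟨l, by omega, by ring⟩
    · rintro ⟨l, hl, rfl⟩
      exact ⟨by omega, ⟨l, by ring⟩⟩
  rw [himg, Finset.sum_image (fun a _ b _ h => by simpa using h)]
  have hterm : ∀ l ∈ range (j + 1), ((2 * j).choose (2 * l) : ℝ)
      * (∫ θ in (0 : ℝ)..2 * π, cos θ ^ (2 * l)) * (∫ θ in (0 : ℝ)..2 * π, cos θ ^ (2 * j - 2 * l))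
      = 4 * π ^ 2 / 4 ^ j * (((2 * j).choose (2 * l) : ℝ) * (Nat.centralBinom l : ℝ)
        * (Nat.centralBinom (j - l) : ℝ)) := by
    intro l hl
    have hlj : l ≤ j := Nat.lt_succ_iff.mp (Finset.mem_range.mp hl)
    rw [show 2 * j - 2 * l = 2 * (j - l) by omega, planarPressureAM_integral_cos_pow_even,
      planarPressureAM_integral_cos_pow_even]
    have h4 : (4 : ℝ) ^ j = 4 ^ l * 4 ^ (j - l) := by
      rw [← pow_add, Nat.add_sub_cancel' hlj]
    rw [h4]
    have : (4 : ℝ) ^ l ≠ 0 := pow_ne_zero _ (by norm_num)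
    have : (4 : ℝ) ^ (j - l) ≠ 0 := pow_ne_zero _ (by norm_num)
    field_simp
    ring
  rw [Finset.sum_congr rfl hterm, ← Finset.mul_sum, planarPressureAM_sum_choose_centralBinom]
  ring

/-- The odd torus moment vanishes: `∑ᵢ C(2j+1,i) J_i J_{2j+1-i} = 0`. [folklore] -/
theorem planarPressureAM_moment_odd (j : ℕ) :
    ∑ i ∈ range (2 * j + 2), ((2 * j + 1).choose i : ℝ) * (∫ θ in (0 : ℝ)..2 * π, cos θ ^ i)
      * (∫ θ in (0 : ℝ)..2 * π, cos θ ^ (2 * j + 1 - i)) = 0 := by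
  apply Finset.sum_eq_zero
  intro i hi
  have hi' : i ≤ 2 * j + 1 := Nat.lt_succ_iff.mp (Finset.mem_range.mp hi)
  rcases Nat.even_or_odd i with ⟨l, rfl⟩ | ⟨l, rfl⟩
  · rw [show 2 * j + 1 - (l + l) = 2 * (j - l) + 1 by omega, planarPressureAM_integral_cos_pow_odd]
    simp
  · rw [planarPressureAM_integral_cos_pow_odd]
    simp

end Summit.CriticalPhenomena.Ising3DConformalLimit.Theorems
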